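import Summits.QuantumFields.BalabanUV.Beta.GAN24.CombesThomas
import Summits.QuantumFields.BalabanUV.Beta.BorderedHessianStep

/-!
# `BalabanUV.Beta.GAN24.DepthTowerPrefactors` — binder row G-an2-4 ∕ (CONV-C), W-slot (α-0), typer's PART VI row **T6-VAL**, the (γ) hand's letter **K7-b** (memo
# `HOME/b2b-balaban-gan24-formalise-leaf-06/g55/HX-VALUES-g55.md` §4 (K7-b), §6 `hc` ∕ `hc0`): **THE PREFACTOR OF THE E⊗E FACE WORD OF THE LEVEL-`j` FORCING GROWS BY EXACTLY
# `ρ = Lc^{2(d+1)}` PER LEVEL, FROM LEVEL `0` ON** — with the tree's units (`sfStep Lc j = Lc^j`, `smStep d Lc j = Lc^{j(d+1)}`, `stepScale_j = (Lc^j)^{d+2}`, `wVH_j = (Lc^j)^{2(d+2)}`,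
# `wE_j = (Lc^j)^{3(d+2)}`) the composite scalar in front of the cell pairing — leaf-02 Part 47's `c·(−K_j²)` (legs), Part 45∕46's `K_j²` (bonds; `K_j = (s_f s_m)(stepScale_j Lc^{d+1})⁻¹`),
# and this lineage's value files' `K_E²·(−½)(½)·s_f²·wVH_j⁻¹` (`K_E = (s_f s_m)⁻¹s_f⁻²·(cE·wE_j)`; g56 `FaceWordEEValueDeep.cellPairing_deep_value_units`, g57 `FaceWordEEValueZero`) — is
# `(c·cE²∕4)·Lc^{−4(d+1)}·Lc^{2j(d+1)}` IN CLOSED FORM, every `j ≥ 0` (`wE_0 = 1` makes the level-`0` amplitude `cE` fit the same formula): hence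
# `CrossedLedgerTelescope`'s `hc : c (k+2) = ρ·c (k+1)` AND `hc0 : c 1 = ρ·c 0` with `ρ = Lc^{2(d+1)}`, the SAME `ρ` that K3 puts in front of the tent
# (G-an2-4 CRUX TEAM (2), seat `b2b-balaban-gan24-formalise-leaf-06` = the (γ) hand, gen 57; journal [GAN24LEAF06-G57-INTENT-1])

NOT IN PRINT; OUR BOOKKEEPING ([folklore] `field_simp` ∕ `ring` over the unit DEFINITIONS `CombesThomas.sfStep ∕ smStep`, `BorderedHessian.stepScale`, `BalabanStepJetsSucc.wVH ∕ wE`; 0 `def`,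
0 cited fact, 0 `def … : Prop`, 0 sorry).  HONEST FRAMING (cell contract, verbatim): «discharging `BetaPertH` makes Bałaban's UV stability UNCONDITIONAL — a real constructive-QFT result;
it is NOT the continuum limit and NOT the Clay problem.»  HONEST DEPENDENCY (verbatim): «continuum YM on T⁴ ⇐ BetaPertH ∧ nine spine estimates (0/9 proved); BetaPertH ⇐ (D1) ∧ (D4) ∧
CAP+tail; G-an2-4 gates asym, D1 and NE2/3/4.»

WHY.  Row T6-VAL's depth tower telescopes along the anti-diagonals `level + period-index = const` EXACTLY when the level prefactors obey `c(k+1) = ρ·c(k)` with the `ρ` of the tent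
(`CrossedLedgerTelescope.antidiag_telescope`, hypotheses `hc`, and `valLedger_iff_levelZero`'s `hc0`).  The prefactor of the E⊗E face word of `b̃_j` at the coarse period `P` in
road-P2's literal is the product of three typed scalars (Parts 47 and 45∕46 are stated for EVERY `j`; the value files for `j ≥ 1` (g56) and `j = 0` (g57) have the same shape); THIS FILE
multiplies them out.  READING: `K_j = Lc^{−(d+1)}` is level-free, `K_E²·s_f²·wVH_j⁻¹ = cE²·Lc^{2j(d+1)}`; the scalar is level-free × `Lc^{2j(d+1)}`.  It asserts nothing about
which words survive `LS` (the W word and the response words are leaf-02's 48∕50b ∕ P41) nor about the swapped word (same scalar, indices exchanged).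

WHAT ([folklore]; every `d`, `Lc ≥ 1` via `NeZero`, every `j`, free `c cE`): `wE_zero`, `stepScale_eq`, **`eePrefactor_closed`** (the closed form), **`eePrefactor_succ`** (`P(j+1) = Lc^{2(d+1)}·P(j)`),
**`eePrefactor_one_eq_rho_mul_zero`** (the `j = 0` instance with the level-`0` amplitude `cE`, i.e. `hc0`); §3 `pin_levelZero_faceNumber` — at the pins `d = 3`, `cE = Lc⁴`, `cE₂ = Lc⁸` the level-`0` number `8·P(0)·V^×(0, M) = −4·Lc⁸·(M² − 1)`, leaf-03 g72's target (the adapter count `8` is a READING until the `LS`∕`FFsym` adapter is typed).  Asserts NO value of Bałaban's tables; discharges NOTHING of `hX` ∕ `hXu` ∕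
(C)_{≥1} ∕ `hB0` ∕ `hBF` ∕ (Q-L); NEVER «G-an2-4 closed» as (CONV-C); NOT D1, NOT `BetaPertH`, NOT continuum, NOT Clay.  2026-08-24; no existing file touched.
-/

noncomputable section

open Literature.MathematicalPhysics.QuantumFieldTheory
open Literature.MathematicalPhysics.QuantumFieldTheory.Balaban1983to89
open Literature.MathematicalPhysics.QuantumFieldTheory.Balaban1983to89.Beta
open BalabanStepJetsSucc (wVH wE)
open Summit.QuantumFields.BalabanUV.Beta.BorderedHessian (stepScale)
open Summit.QuantumFields.BalabanUV.Beta.GAN24.CombesThomas (sfStep smStep)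

namespace Summit.QuantumFields.BalabanUV.Beta.GAN24.DepthTowerPrefactors

variable {d : ℕ} {Lc : ℕ} [NeZero Lc]

omit [NeZero Lc] in
/-- [folklore] The `E‴` weight at level `0` is `1` — so the level-`0` amplitude `cE` of the Wilson cubic is `cE·wE_0`. -/
theorem wE_zero : wE d Lc 0 = 1 := by
  unfold BalabanStepJetsSucc.wE
  rw [pow_zero, one_pow]

omit [NeZero Lc] in
/-- [folklore] All units of step `j` are powers of `t = Lc^j`: `sfStep = t`, `smStep = t^{d+1}`, `stepScale = t^{d+2}`, `wVH = t^{2(d+2)}`, `wE = t^{3(d+2)}`. -/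
theorem units_eq (j : ℕ) :
    sfStep Lc j = (Lc : ℝ) ^ j ∧ smStep d Lc j = ((Lc : ℝ) ^ j) ^ (d + 1) ∧ stepScale d Lc j = ((Lc : ℝ) ^ j) ^ (d + 2) ∧
      wVH d Lc j = ((Lc : ℝ) ^ j) ^ (2 * (d + 2)) ∧ wE d Lc j = ((Lc : ℝ) ^ j) ^ (3 * (d + 2)) := by
  refine ⟨rfl, ?_, rfl, rfl, rfl⟩
  unfold CombesThomas.smStep
  rw [pow_mul]

/-- NOT IN PRINT; OUR BOOKKEEPING.  **THE E⊗E FACE-WORD PREFACTOR IN CLOSED FORM** (every `j`): Part 47's leg scalar × Part 45∕46's bond scalar × the value files' scalar, with the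
level-`j` units and the amplitude `cE·wE_j`, equals `(c·cE²∕4)·Lc^{2j(d+1)}∕Lc^{4(d+1)}`. -/
theorem eePrefactor_closed (c cE : ℝ) (j : ℕ) :
    (c * -(((sfStep Lc j * smStep d Lc j) * (stepScale d Lc j * (Lc : ℝ) ^ (d + 1))⁻¹) * ((sfStep Lc j * smStep d Lc j) * (stepScale d Lc j * (Lc : ℝ) ^ (d + 1))⁻¹))) *
      ((((sfStep Lc j * smStep d Lc j) * (stepScale d Lc j * (Lc : ℝ) ^ (d + 1))⁻¹) * ((sfStep Lc j * smStep d Lc j) * (stepScale d Lc j * (Lc : ℝ) ^ (d + 1))⁻¹)) *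
        ((((sfStep Lc j * smStep d Lc j)⁻¹ * ((sfStep Lc j)⁻¹ * (sfStep Lc j)⁻¹) * (cE * wE d Lc j)) *
            ((sfStep Lc j * smStep d Lc j)⁻¹ * ((sfStep Lc j)⁻¹ * (sfStep Lc j)⁻¹) * (cE * wE d Lc j))) *
          ((-(1 / 2 : ℝ)) * (1 / 2 : ℝ) * ((sfStep Lc j * sfStep Lc j) * (wVH d Lc j)⁻¹)))) =
      (c * cE ^ 2 / 4) * (((Lc : ℝ) ^ j) ^ (2 * (d + 1)) / ((Lc : ℝ) ^ (d + 1)) ^ 4) := by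
  obtain ⟨h1, h2, h3, h4, h5⟩ := units_eq (d := d) (Lc := Lc) j
  rw [h1, h2, h3, h4, h5]
  have hL : (Lc : ℝ) ≠ 0 := Nat.cast_ne_zero.mpr (NeZero.ne Lc)
  have ht : ((Lc : ℝ) ^ j) ≠ 0 := pow_ne_zero _ hL
  have hu : ((Lc : ℝ) ^ (d + 1)) ≠ 0 := pow_ne_zero _ hL
  field_simp
  ring

/-- NOT IN PRINT; OUR BOOKKEEPING.  **`hc`: THE PREFACTOR GROWS BY `ρ = Lc^{2(d+1)}` PER LEVEL** (every `j ≥ 0`): `P(j+1) = Lc^{2(d+1)}·P(j)`. -/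
theorem eePrefactor_succ (c cE : ℝ) (j : ℕ) :
    (c * -(((sfStep Lc (j + 1) * smStep d Lc (j + 1)) * (stepScale d Lc (j + 1) * (Lc : ℝ) ^ (d + 1))⁻¹) *
        ((sfStep Lc (j + 1) * smStep d Lc (j + 1)) * (stepScale d Lc (j + 1) * (Lc : ℝ) ^ (d + 1))⁻¹))) *
      ((((sfStep Lc (j + 1) * smStep d Lc (j + 1)) * (stepScale d Lc (j + 1) * (Lc : ℝ) ^ (d + 1))⁻¹) *
          ((sfStep Lc (j + 1) * smStep d Lc (j + 1)) * (stepScale d Lc (j + 1) * (Lc : ℝ) ^ (d + 1))⁻¹)) *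
        ((((sfStep Lc (j + 1) * smStep d Lc (j + 1))⁻¹ * ((sfStep Lc (j + 1))⁻¹ * (sfStep Lc (j + 1))⁻¹) * (cE * wE d Lc (j + 1))) *
            ((sfStep Lc (j + 1) * smStep d Lc (j + 1))⁻¹ * ((sfStep Lc (j + 1))⁻¹ * (sfStep Lc (j + 1))⁻¹) * (cE * wE d Lc (j + 1)))) *
          ((-(1 / 2 : ℝ)) * (1 / 2 : ℝ) * ((sfStep Lc (j + 1) * sfStep Lc (j + 1)) * (wVH d Lc (j + 1))⁻¹)))) =
      (Lc : ℝ) ^ (2 * (d + 1)) *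
        ((c * -(((sfStep Lc j * smStep d Lc j) * (stepScale d Lc j * (Lc : ℝ) ^ (d + 1))⁻¹) * ((sfStep Lc j * smStep d Lc j) * (stepScale d Lc j * (Lc : ℝ) ^ (d + 1))⁻¹))) *
          ((((sfStep Lc j * smStep d Lc j) * (stepScale d Lc j * (Lc : ℝ) ^ (d + 1))⁻¹) * ((sfStep Lc j * smStep d Lc j) * (stepScale d Lc j * (Lc : ℝ) ^ (d + 1))⁻¹)) *
            ((((sfStep Lc j * smStep d Lc j)⁻¹ * ((sfStep Lc j)⁻¹ * (sfStep Lc j)⁻¹) * (cE * wE d Lc j)) *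
                ((sfStep Lc j * smStep d Lc j)⁻¹ * ((sfStep Lc j)⁻¹ * (sfStep Lc j)⁻¹) * (cE * wE d Lc j))) *
              ((-(1 / 2 : ℝ)) * (1 / 2 : ℝ) * ((sfStep Lc j * sfStep Lc j) * (wVH d Lc j)⁻¹))))) := by
  rw [eePrefactor_closed, eePrefactor_closed]
  have hL : (Lc : ℝ) ≠ 0 := Nat.cast_ne_zero.mpr (NeZero.ne Lc)
  have hu : ((Lc : ℝ) ^ (d + 1)) ≠ 0 := pow_ne_zero _ hL
  field_simp
  ring

/-- NOT IN PRINT; OUR BOOKKEEPING.  **`hc0`: LEVEL `0` FITS** — with the level-`0` units `sfStep Lc 0 = smStep d Lc 0 = 1` and the Wilson cubic's amplitude `cE` (no `wE` weight), the level-`1`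
prefactor is `ρ = Lc^{2(d+1)}` times the level-`0` one. -/
theorem eePrefactor_one_eq_rho_mul_zero (c cE : ℝ) :
    (c * -(((sfStep Lc 1 * smStep d Lc 1) * (stepScale d Lc 1 * (Lc : ℝ) ^ (d + 1))⁻¹) * ((sfStep Lc 1 * smStep d Lc 1) * (stepScale d Lc 1 * (Lc : ℝ) ^ (d + 1))⁻¹))) *
      ((((sfStep Lc 1 * smStep d Lc 1) * (stepScale d Lc 1 * (Lc : ℝ) ^ (d + 1))⁻¹) * ((sfStep Lc 1 * smStep d Lc 1) * (stepScale d Lc 1 * (Lc : ℝ) ^ (d + 1))⁻¹)) *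
        ((((sfStep Lc 1 * smStep d Lc 1)⁻¹ * ((sfStep Lc 1)⁻¹ * (sfStep Lc 1)⁻¹) * (cE * wE d Lc 1)) *
            ((sfStep Lc 1 * smStep d Lc 1)⁻¹ * ((sfStep Lc 1)⁻¹ * (sfStep Lc 1)⁻¹) * (cE * wE d Lc 1))) *
          ((-(1 / 2 : ℝ)) * (1 / 2 : ℝ) * ((sfStep Lc 1 * sfStep Lc 1) * (wVH d Lc 1)⁻¹)))) =
      (Lc : ℝ) ^ (2 * (d + 1)) *
        ((c * -(((sfStep Lc 0 * smStep d Lc 0) * (stepScale d Lc 0 * (Lc : ℝ) ^ (d + 1))⁻¹) * ((sfStep Lc 0 * smStep d Lc 0) * (stepScale d Lc 0 * (Lc : ℝ) ^ (d + 1))⁻¹))) *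
          ((((sfStep Lc 0 * smStep d Lc 0) * (stepScale d Lc 0 * (Lc : ℝ) ^ (d + 1))⁻¹) * ((sfStep Lc 0 * smStep d Lc 0) * (stepScale d Lc 0 * (Lc : ℝ) ^ (d + 1))⁻¹)) *
            ((((sfStep Lc 0 * smStep d Lc 0)⁻¹ * ((sfStep Lc 0)⁻¹ * (sfStep Lc 0)⁻¹) * cE) *
                ((sfStep Lc 0 * smStep d Lc 0)⁻¹ * ((sfStep Lc 0)⁻¹ * (sfStep Lc 0)⁻¹) * cE)) *
              ((-(1 / 2 : ℝ)) * (1 / 2 : ℝ) * ((sfStep Lc 0 * sfStep Lc 0) * (wVH d Lc 0)⁻¹))))) := by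
  have h := eePrefactor_succ (d := d) (Lc := Lc) c cE 0
  rw [wE_zero, mul_one] at h
  exact h

/-! ## §3 The pin arithmetic: the level-`0` number of leaf-03's closure -/

/-- NOT IN PRINT; OUR BOOKKEEPING.  **AT THE LITERAL's PINS THE LEVEL-`0` E⊗E FACE VALUE IS leaf-03 g72's TARGET NUMBER.**  `d = 3`, `cE = Lc⁴`, `cE₂ = Lc⁸`, forcing scale
`c = cE₂·Lc^{2(3+1)}`: §2's closed-form prefactor at `j = 0` is `P(0) = Lc⁸∕4`, and with the crossed-pattern value of the level-`0` pairing at the fine period `M`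
(`WilsonProfilePairing.sum_box_qProfile_E2zero_qProfile`, pattern `(ba;ab)`: `2·(0 − 1)·M^{3−1}·(1 − M⁻²)`) and the adapter count `8 = 2 × 4` (READING, weight 0 until the `LS`∕`FFsym`
adapter is typed: `FFsym` doubles; of the four crossed patterns of `X`, each carries one non-diagonal direct∕swapped word, all equal to the `(ba;ab)` value), the product
`8·((c·cE²∕4)·((Lc^0)^{2(d+1)}∕(Lc^{d+1})⁴))·(2·(0−1)·M²(1 − M⁻²))` is `−4·Lc⁸·(M² − 1)` — the right-hand side `c 0·R m = −4·Lc⁸·(Lc²·(P m)² − 1)` of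
`CrossedLedgerClosure.valLedger_all_iff_target_pin` at `M = Lc·P m`.  A scalar identity; nothing of the ledger is asserted. -/
theorem pin_levelZero_faceNumber {c cE cE₂ : ℝ} (hcE : cE = (Lc : ℝ) ^ (3 + 1)) (hcE₂ : cE₂ = (Lc : ℝ) ^ (2 * (3 + 1)))
    (hc : c = cE₂ * (Lc : ℝ) ^ (2 * (3 + 1))) (M : ℝ) (hM : M ≠ 0) :
    8 * ((c * cE ^ 2 / 4) * ((((Lc : ℝ) ^ 0) ^ (2 * (3 + 1))) / ((Lc : ℝ) ^ (3 + 1)) ^ 4)) * (2 * ((0 : ℝ) - 1) * (M ^ (3 - 1) * (1 - M⁻¹ * M⁻¹))) =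
      -4 * (Lc : ℝ) ^ 8 * (M ^ 2 - 1) := by
  subst hcE hcE₂ hc
  have hL : (Lc : ℝ) ≠ 0 := Nat.cast_ne_zero.mpr (NeZero.ne Lc)
  field_simp
  ring

end Summit.QuantumFields.BalabanUV.Beta.GAN24.DepthTowerPrefactors

end
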